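import Mathlib
import Literature.NumberTheory.Sieve.LargestPrimeFactorCubic
import Literature.NumberTheory.LFunctions.VanDerCorputZeta
import HarnessLib

/-!
# Heath-Brown's `q`-analogue of van der Corput: the differencing step (PLMS 82 (2001), §9)

Topic `Literature/NumberTheory/Sieve`, grouping namespace `ShortKloosterman` (the short
Kloosterman-type sums `Σ_{A<n≤A+B} e_q(w f(n) \overline{g(n)})` of
`Literature.NumberTheory.Sieve.shortKloostermanSum`, Heath-Brown 2001 Theorem 2 =
`HeathBrown2001_thm2_shortKloosterman`).  This file PROVES the algebra of the induction step of
the printed proof of Theorem 2 (D. R. Heath-Brown, *The largest prime factor of `X³ + 2`*,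
Proc. London Math. Soc. (3) 82 (2001) 554–596, §9 pp. 588–591 = pp. 36–38 of the Oxford eprint):

* §1 `shiftQuot t f` — the exact difference quotient `D_t f ∈ R[X]` with
  `t · D_t f = f(X + t) − f(X)` (`C_mul_shiftQuot`), its degree (`natDegree_shiftQuot_le`),
  functoriality (`map_shiftQuot`) and `D_0 f = f'` (`shiftQuot_zero`);
* §2 `diffNum t f g = u`, `diffDen t g = v` — Heath-Brown's
  `u(X) = {g(X) f(X+t) − f(X) g(X+t)}/t`, `v(X) = g(X) g(X+t)` (p. 37), with
  `t u = g f(X+t) − f g(X+t)`, `deg u, deg v ≤ 2D`, reduction modulo `p`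
  (`p ∤ t`: the same formula over `𝔽_p`; `p ∣ t`: `u ≡ g f' − f g'`, `v ≡ g²`);
* §3 **the transfer lemma** (`not_exists_diffNum_eq_mul`, p. 37–38): over a field in which
  `1, …, D` are non-zero, if `deg f, deg g ≤ D`, `g ≠ 0` and there is no `h` with `deg h ≤ k + 1`
  and `f = g h`, then there is no `h` with `deg h ≤ k` and `u = v h` — both printed cases
  (`t ≠ 0` via the g.c.d. `d`, `f = dF`, `g = dG`, `G(X+t) = G(X) ⇒ G` constant,
  `deg (F(X+t) − F(X)) = deg F − 1`; `t = 0`, i.e. `p ∣ t`, via `G ∣ G' ⇒ G' = 0 ⇒ G` constant,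
  `F' = h`).

Everything here is elementary polynomial algebra; no named facts are introduced.

## References

* D. R. Heath-Brown, *The largest prime factor of `X³ + 2`*, Proc. London Math. Soc. (3) 82
  (2001) 554–596, §9 (proof of Theorem 2), pp. 36–38 of the held text
  `paper:heathbrown2001-largest-prime-factor-i-x-i-sup`. [`HeathBrown2001LargestPrimeFactorCubic`]
-/

noncomputable section

open Finset Polynomial

namespace Literature.NumberTheory.Sieve

namespace ShortKloosterman

/-! ### §1. The exact difference quotient `D_t f = (f(X + t) − f(X)) / t` -/

section Ring

variable {R : Type*} [CommRing R]

/-- The exact difference quotient `D_t f = Σ_i a_i Σ_{j<i} (X + t)^j X^{i−1−j} ∈ R[X]` of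
`f = Σ_i a_i X^i`: the polynomial with `t · D_t f = f(X + t) − f(X)` (no division by `t` is
performed, so `t` may be a zero-divisor or `0`).
[cite: HeathBrown2001LargestPrimeFactorCubic, §9 p. 37 (the quotient `{g(X)f(X+t) − f(X)g(X+t)}/t`)] -/
def shiftQuot (t : R) (f : R[X]) : R[X] :=
  ∑ i ∈ range (f.natDegree + 1), C (f.coeff i) * ∑ j ∈ range i, (X + C t) ^ j * X ^ (i - 1 - j)

/-- The defining sum may be taken over any range beyond the degree. [folklore] -/
theorem shiftQuot_eq_sum_range (t : R) (f : R[X]) {N : ℕ} (hN : f.natDegree < N) :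
    shiftQuot t f =
      ∑ i ∈ range N, C (f.coeff i) * ∑ j ∈ range i, (X + C t) ^ j * X ^ (i - 1 - j) := by
  unfold shiftQuot
  refine Finset.sum_subset (fun i hi => ?_) (fun i _ hi => ?_)
  · rw [mem_range] at hi ⊢; omega
  · rw [mem_range, Nat.lt_succ_iff, not_le] at hi
    rw [coeff_eq_zero_of_natDegree_lt hi, C_0, zero_mul]

/-- **`t · D_t f = f(X + t) − f(X)`.** [folklore] -/
theorem C_mul_shiftQuot (t : R) (f : R[X]) :
    C t * shiftQuot t f = f.comp (X + C t) - f := by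
  have hgeom : ∀ i : ℕ, C t * ∑ j ∈ range i, (X + C t) ^ j * X ^ (i - 1 - j) =
      (X + C t) ^ i - X ^ i := by
    intro i
    rw [mul_comm, ← Commute.geom_sum₂_mul (Commute.all _ _) i]
    congr 1
    ring
  unfold shiftQuot
  rw [Finset.mul_sum]
  have hterm : ∀ i ∈ range (f.natDegree + 1),
      C t * (C (f.coeff i) * ∑ j ∈ range i, (X + C t) ^ j * X ^ (i - 1 - j)) =
        C (f.coeff i) * (X + C t) ^ i - C (f.coeff i) * X ^ i := by
    intro i _
    rw [mul_left_comm, hgeom, mul_sub]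
  rw [Finset.sum_congr rfl hterm, Finset.sum_sub_distrib]
  congr 1
  · rw [comp_eq_sum_left, sum_over_range]
    intro n
    rw [C_0, zero_mul]
  · conv_rhs => rw [← sum_C_mul_X_pow_eq f]
    rw [sum_over_range]
    intro n
    rw [C_0, zero_mul]

/-- `deg D_t f ≤ deg f − 1`. [folklore] -/
theorem natDegree_shiftQuot_le (t : R) (f : R[X]) :
    (shiftQuot t f).natDegree ≤ f.natDegree - 1 := by
  unfold shiftQuot
  refine natDegree_sum_le_of_forall_le _ _ fun i hi => ?_
  rw [mem_range] at hi
  refine (natDegree_C_mul_le _ _).trans ?_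
  refine (natDegree_sum_le_of_forall_le _ _ fun j hj => ?_).trans (Nat.sub_le_sub_right
    (Nat.lt_succ_iff.mp hi) 1)
  rw [mem_range] at hj
  have h1 : (X + C t : R[X]).natDegree ≤ 1 :=
    (natDegree_add_le _ _).trans (max_le natDegree_X_le (by rw [natDegree_C]; exact Nat.zero_le _))
  have h2 : ((X + C t : R[X]) ^ j).natDegree ≤ j := by
    simpa using natDegree_pow_le_of_le j h1
  have h3 : ((X : R[X]) ^ (i - 1 - j)).natDegree ≤ i - 1 - j := natDegree_pow_le_of_le _ natDegree_X_le
    |>.trans (by simp)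
  refine natDegree_mul_le.trans ?_
  omega

/-- `deg D_t f ≤ deg f`. [folklore] -/
theorem natDegree_shiftQuot_le' (t : R) (f : R[X]) :
    (shiftQuot t f).natDegree ≤ f.natDegree :=
  (natDegree_shiftQuot_le t f).trans (Nat.sub_le _ _)

/-- Functoriality: `D_t f` commutes with ring homomorphisms. [folklore] -/
theorem map_shiftQuot {S : Type*} [CommRing S] (φ : R →+* S) (t : R) (f : R[X]) :
    (shiftQuot t f).map φ = shiftQuot (φ t) (f.map φ) := by
  rw [shiftQuot_eq_sum_range (φ t) (f.map φ)
    (lt_of_le_of_lt (natDegree_map_le) (Nat.lt_succ_self _))]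
  unfold shiftQuot
  rw [Polynomial.map_sum]
  refine Finset.sum_congr rfl fun i _ => ?_
  rw [Polynomial.map_mul, map_C, coeff_map, Polynomial.map_sum]
  congr 1
  refine Finset.sum_congr rfl fun j _ => ?_
  rw [Polynomial.map_mul, Polynomial.map_pow, Polynomial.map_pow, Polynomial.map_add, map_X,
    map_C]

/-- **`D_0 f = f'`**: at `t = 0` the difference quotient is the derivative. [folklore] -/
theorem shiftQuot_zero (f : R[X]) : shiftQuot (0 : R) f = derivative f := by
  unfold shiftQuot
  rw [derivative_apply, sum_over_range _ (fun n => by rw [zero_mul, C_0, zero_mul])]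
  refine Finset.sum_congr rfl fun i _ => ?_
  have hin : ∀ j ∈ range i, (X + C (0 : R)) ^ j * X ^ (i - 1 - j) = X ^ (i - 1) := by
    intro j hj
    rw [mem_range] at hj
    rw [C_0, add_zero, ← pow_add]
    congr 1
    omega
  rw [Finset.sum_congr rfl hin, sum_const, card_range, nsmul_eq_mul, C_mul, ← mul_assoc,
    C_eq_natCast]

/-! ### §2. Heath-Brown's `u` and `v` -/

/-- Heath-Brown's `u(X) = {g(X) f(X + t) − f(X) g(X + t)} / t`, as the exact quotient
`g · D_t f − f · D_t g`. [cite: HeathBrown2001LargestPrimeFactorCubic, §9 p. 37] -/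
def diffNum (t : R) (f g : R[X]) : R[X] :=
  g * shiftQuot t f - f * shiftQuot t g

/-- Heath-Brown's `v(X) = g(X) g(X + t)`. [cite: HeathBrown2001LargestPrimeFactorCubic, §9 p. 37] -/
def diffDen (t : R) (g : R[X]) : R[X] :=
  g * g.comp (X + C t)

/-- **`t · u = g(X) f(X+t) − f(X) g(X+t)`.** [cite: HeathBrown2001LargestPrimeFactorCubic, §9 p. 37] -/
theorem C_mul_diffNum (t : R) (f g : R[X]) :
    C t * diffNum t f g = g * f.comp (X + C t) - f * g.comp (X + C t) := by
  unfold diffNum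
  rw [mul_sub, mul_left_comm, C_mul_shiftQuot, mul_left_comm, C_mul_shiftQuot]
  ring

/-- `deg u ≤ deg f + deg g − 1 ≤ 2D`. [cite: HeathBrown2001LargestPrimeFactorCubic, §9 p. 37] -/
theorem natDegree_diffNum_le {t : R} {f g : R[X]} {D : ℕ} (hf : f.natDegree ≤ D)
    (hg : g.natDegree ≤ D) : (diffNum t f g).natDegree ≤ 2 * D := by
  unfold diffNum
  refine (natDegree_sub_le _ _).trans (max_le ?_ ?_)
  · refine natDegree_mul_le.trans ?_
    have := natDegree_shiftQuot_le' t f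
    omega
  · refine natDegree_mul_le.trans ?_
    have := natDegree_shiftQuot_le' t g
    omega

/-- `deg v ≤ 2 deg g ≤ 2D`. [cite: HeathBrown2001LargestPrimeFactorCubic, §9 p. 37] -/
theorem natDegree_diffDen_le {t : R} {g : R[X]} {D : ℕ} (hg : g.natDegree ≤ D) :
    (diffDen t g).natDegree ≤ 2 * D := by
  unfold diffDen
  refine natDegree_mul_le.trans ?_
  have h1 : (X + C t : R[X]).natDegree ≤ 1 :=
    (natDegree_add_le _ _).trans (max_le natDegree_X_le (by rw [natDegree_C]; exact Nat.zero_le _))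
  have h2 : (g.comp (X + C t)).natDegree ≤ g.natDegree := by
    refine natDegree_comp_le.trans ?_
    calc g.natDegree * (X + C t : R[X]).natDegree ≤ g.natDegree * 1 :=
          Nat.mul_le_mul_left _ h1
      _ = g.natDegree := mul_one _
  omega

/-- Functoriality of `u`. [folklore] -/
theorem map_diffNum {S : Type*} [CommRing S] (φ : R →+* S) (t : R) (f g : R[X]) :
    (diffNum t f g).map φ = diffNum (φ t) (f.map φ) (g.map φ) := by
  unfold diffNum
  rw [Polynomial.map_sub, Polynomial.map_mul, Polynomial.map_mul, map_shiftQuot, map_shiftQuot]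

/-- Functoriality of `v`. [folklore] -/
theorem map_diffDen {S : Type*} [CommRing S] (φ : R →+* S) (t : R) (g : R[X]) :
    (diffDen t g).map φ = diffDen (φ t) (g.map φ) := by
  unfold diffDen
  rw [Polynomial.map_mul, map_comp, Polynomial.map_add, map_X, map_C]

/-- At `t = 0`: `u = g f' − f g'`. [cite: HeathBrown2001LargestPrimeFactorCubic, §9 p. 37 (case `p ∣ t`)] -/
theorem diffNum_zero (f g : R[X]) :
    diffNum (0 : R) f g = g * derivative f - f * derivative g := by
  unfold diffNum
  rw [shiftQuot_zero, shiftQuot_zero]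

/-- At `t = 0`: `v = g²`. [cite: HeathBrown2001LargestPrimeFactorCubic, §9 p. 38 (case `p ∣ t`)] -/
theorem diffDen_zero (g : R[X]) : diffDen (0 : R) g = g * g := by
  unfold diffDen
  rw [C_0, add_zero, comp_X]

/-- Evaluation: `t · u(n) = g(n) f(n + t) − f(n) g(n + t)`.
[cite: HeathBrown2001LargestPrimeFactorCubic, §9 p. 37] -/
theorem mul_eval_diffNum (t n : R) (f g : R[X]) :
    t * (diffNum t f g).eval n = g.eval n * f.eval (n + t) - f.eval n * g.eval (n + t) := by
  have h := congrArg (eval n) (C_mul_diffNum t f g)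
  simp only [eval_mul, eval_C, eval_sub, eval_comp, eval_add, eval_X] at h
  exact h

/-- Evaluation: `v(n) = g(n) g(n + t)`. [cite: HeathBrown2001LargestPrimeFactorCubic, §9 p. 37] -/
theorem eval_diffDen (t n : R) (g : R[X]) :
    (diffDen t g).eval n = g.eval n * g.eval (n + t) := by
  unfold diffDen
  simp only [eval_mul, eval_comp, eval_add, eval_X, eval_C]

end Ring

/-! ### §3. The transfer lemma over a field -/

section Field

variable {F : Type*} [Field F]

/-- A polynomial of degree `n ≥ 1` with `n ≠ 0` in `F` is not invariant under a non-zero shift: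
the coefficient of `X^{n−1}` in `G(X + t) − G(X)` is `n t · lc(G)`. [folklore] -/
theorem coeff_comp_X_add_C_sub (G : F[X]) (t : F) {n : ℕ} (hn : G.natDegree = n + 1) :
    (G.comp (X + C t) - G).coeff n = (n + 1 : ℕ) * t * G.leadingCoeff := by
  rw [coeff_sub, ← taylor_apply, taylor_coeff]
  -- `hasseDeriv n G` has degree `≤ 1`, with coefficients `G.coeff n` and `(n+1) G.coeff (n+1)`
  have hdeg : (hasseDeriv n G).natDegree ≤ 1 := by
    refine (natDegree_hasseDeriv_le G n).trans ?_
    omega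
  rw [eval_eq_sum_range' (n := 2) (by omega), Finset.sum_range_succ, Finset.sum_range_one,
    hasseDeriv_coeff, hasseDeriv_coeff, zero_add, Nat.choose_self, Nat.cast_one, one_mul, pow_zero,
    mul_one, pow_one, show 1 + n = n + 1 by ring, Nat.choose_succ_self_right]
  rw [leadingCoeff, hn]
  ring

/-- `G(X + t) = G(X)` with `t ≠ 0` and `deg G` invertible in `F` forces `G` constant.
[cite: HeathBrown2001LargestPrimeFactorCubic, §9 p. 37 ("we must conclude that G(X) is constant")] -/
theorem natDegree_eq_zero_of_comp_X_add_C_eq {G : F[X]} {t : F} (ht : t ≠ 0)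
    (hchar : ((G.natDegree : ℕ) : F) ≠ 0) (h : G.comp (X + C t) = G) : G.natDegree = 0 := by
  by_contra hne
  obtain ⟨n, hn⟩ : ∃ n, G.natDegree = n + 1 := ⟨G.natDegree - 1, by omega⟩
  have hc := coeff_comp_X_add_C_sub G t hn
  rw [h, sub_self, coeff_zero] at hc
  have hlc : G.leadingCoeff ≠ 0 := by
    rw [Ne, leadingCoeff_eq_zero]
    rintro rfl
    simp at hn
  rw [hn] at hchar
  exact mul_ne_zero (mul_ne_zero hchar ht) hlc hc.symm

/-- `deg (F(X + t) − F(X)) ≥ deg F − 1` for `t ≠ 0` and `deg F` invertible in `F`.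
[cite: HeathBrown2001LargestPrimeFactorCubic, §9 p. 37 ("deg(F(X+t) − F(X)) = deg(F(X)) − 1")] -/
theorem natDegree_sub_one_le_natDegree_comp_sub {P : F[X]} {t : F} (ht : t ≠ 0)
    (hchar : ((P.natDegree : ℕ) : F) ≠ 0) :
    P.natDegree - 1 ≤ (P.comp (X + C t) - P).natDegree := by
  rcases Nat.eq_zero_or_pos P.natDegree with h0 | hpos
  · rw [h0]; exact Nat.zero_le _
  obtain ⟨n, hn⟩ : ∃ n, P.natDegree = n + 1 := ⟨P.natDegree - 1, by omega⟩
  have hc := coeff_comp_X_add_C_sub P t hn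
  have hlc : P.leadingCoeff ≠ 0 := by
    rw [Ne, leadingCoeff_eq_zero]; rintro rfl; simp at hn
  rw [hn] at hchar
  have hne : (P.comp (X + C t) - P).coeff n ≠ 0 := by
    rw [hc]; exact mul_ne_zero (mul_ne_zero hchar ht) hlc
  rw [hn, Nat.add_sub_cancel]
  exact le_natDegree_of_ne_zero hne

/-- `deg F' ≥ deg F − 1` when `deg F` is invertible in `F`. [folklore] -/
theorem natDegree_sub_one_le_natDegree_derivative {P : F[X]}
    (hchar : ((P.natDegree : ℕ) : F) ≠ 0) : P.natDegree - 1 ≤ (derivative P).natDegree := by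
  rcases Nat.eq_zero_or_pos P.natDegree with h0 | hpos
  · rw [h0]; exact Nat.zero_le _
  obtain ⟨n, hn⟩ : ∃ n, P.natDegree = n + 1 := ⟨P.natDegree - 1, by omega⟩
  have hlc : P.leadingCoeff ≠ 0 := by
    rw [Ne, leadingCoeff_eq_zero]; rintro rfl; simp at hn
  rw [hn] at hchar
  have hne : (derivative P).coeff n ≠ 0 := by
    rw [coeff_derivative]
    refine mul_ne_zero ?_ (by exact_mod_cast hchar)
    rw [leadingCoeff, hn] at hlc
    exact hlc
  rw [hn, Nat.add_sub_cancel]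
  exact le_natDegree_of_ne_zero hne

/-- `G' = 0` with `deg G` invertible in `F` forces `G` constant. [folklore] -/
theorem natDegree_eq_zero_of_derivative_eq_zero {G : F[X]}
    (hchar : ((G.natDegree : ℕ) : F) ≠ 0) (h : derivative G = 0) : G.natDegree = 0 := by
  have := natDegree_sub_one_le_natDegree_derivative hchar
  rw [h, natDegree_zero] at this
  by_contra hne
  -- if `deg G = n + 1 ≥ 1` then `n ≤ 0` gives `n = 0`, but then the coefficient argument applies
  obtain ⟨n, hn⟩ : ∃ n, G.natDegree = n + 1 := ⟨G.natDegree - 1, by omega⟩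
  have hlc : G.leadingCoeff ≠ 0 := by
    rw [Ne, leadingCoeff_eq_zero]; rintro rfl; simp at hn
  have hne' : (derivative G).coeff n ≠ 0 := by
    rw [coeff_derivative]
    rw [hn] at hchar
    refine mul_ne_zero ?_ (by exact_mod_cast hchar)
    rw [leadingCoeff, hn] at hlc
    exact hlc
  rw [h, coeff_zero] at hne'
  exact hne' rfl

/-- The g.c.d. decomposition over a field: `f = d F`, `g = d G` with `d ≠ 0` and `F, G` coprime
(Bézout), provided `g ≠ 0`. [folklore] -/
theorem exists_gcd_decomposition (f g : F[X]) (hg : g ≠ 0) :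
    ∃ d P Q : F[X], d ≠ 0 ∧ f = d * P ∧ g = d * Q ∧ IsCoprime P Q := by
  classical
  set d := EuclideanDomain.gcd f g with hd
  obtain ⟨P, hP⟩ := EuclideanDomain.gcd_dvd_left f g
  obtain ⟨Q, hQ⟩ := EuclideanDomain.gcd_dvd_right f g
  have hd0 : d ≠ 0 := by
    intro h0
    rw [← hd, h0, zero_mul] at hQ
    exact hg hQ
  refine ⟨d, P, Q, hd0, hP, hQ, ?_⟩
  have hbez := EuclideanDomain.gcd_eq_gcd_ab f g
  rw [← hd] at hbez hP hQ
  refine ⟨EuclideanDomain.gcdA f g, EuclideanDomain.gcdB f g, ?_⟩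
  apply mul_left_cancel₀ hd0
  rw [mul_one]
  conv_rhs => rw [hbez]
  rw [hP, hQ] at *
  ring

/-- **Heath-Brown's transfer lemma, case `p ∤ t`** (p. 37). Over a field `F` in which
`1, 2, …, D ≠ 0`, let `deg f, deg g ≤ D`, `g ≠ 0`, `t ≠ 0`, and suppose `f ≠ g h` for every `h`
with `deg h ≤ k + 1`. Then `u ≠ v h` for every `h` with `deg h ≤ k`, where
`u = {g f(X+t) − f g(X+t)}/t`, `v = g g(X+t)`.
[cite: HeathBrown2001LargestPrimeFactorCubic, §9 p. 37] -/
theorem not_exists_diffNum_eq_mul_of_ne_zero {f g : F[X]} {D k : ℕ} (hf : f.natDegree ≤ D)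
    (hg : g.natDegree ≤ D) (hg0 : g ≠ 0) (hchar : ∀ n : ℕ, 1 ≤ n → n ≤ D → (n : F) ≠ 0)
    {t : F} (ht : t ≠ 0) (hnd : ¬ ∃ h : F[X], h.natDegree ≤ k + 1 ∧ f = g * h) :
    ¬ ∃ h : F[X], h.natDegree ≤ k ∧ diffNum t f g = diffDen t g * h := by
  rintro ⟨h, hhk, hu⟩
  have hf0 : f ≠ 0 := by
    rintro rfl
    exact hnd ⟨0, by simp, by simp⟩
  obtain ⟨d, P, Q, hd0, hfP, hgQ, hcop⟩ := exists_gcd_decomposition f g hg0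
  have hQ0 : Q ≠ 0 := by rintro rfl; rw [mul_zero] at hgQ; exact hg0 hgQ
  have hP0 : P ≠ 0 := by rintro rfl; rw [mul_zero] at hfP; exact hf0 hfP
  set s : F[X] := X + C t with hs
  have hs1 : s.natDegree = 1 := natDegree_X_add_C t
  have hds0 : d.comp s ≠ 0 := by
    intro h0
    rw [comp_eq_zero_iff] at h0
    rcases h0 with h0 | ⟨_, h0⟩
    · exact hd0 h0
    · have := congrArg natDegree h0
      rw [hs1, natDegree_C] at this
      exact one_ne_zero this
  -- the basic identity `t u = g f(X+t) − f g(X+t)` rewritten through `f = dP`, `g = dQ`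
  have hid : C t * (diffDen t g * h) = g * f.comp s - f * g.comp s := by
    rw [← hu, C_mul_diffNum]
  have hid2 : d * d.comp s * (Q * P.comp s - P * Q.comp s) =
      d * d.comp s * (C t * Q * Q.comp s * h) := by
    have e1 : g * f.comp s - f * g.comp s = d * d.comp s * (Q * P.comp s - P * Q.comp s) := by
      rw [hfP, hgQ, mul_comp, mul_comp]; ring
    have e2 : C t * (diffDen t g * h) = d * d.comp s * (C t * Q * Q.comp s * h) := by
      unfold diffDen; rw [hgQ, mul_comp]; ring
    rw [← e1, ← e2, hid]
  have hkey : Q * P.comp s - P * Q.comp s = C t * Q * Q.comp s * h :=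
    mul_left_cancel₀ (mul_ne_zero hd0 hds0) hid2
  -- `Q ∣ P · Q(X+t)`, hence `Q ∣ Q(X+t)` by coprimality
  have hdvd : Q ∣ P * Q.comp s := by
    have : P * Q.comp s = Q * P.comp s - C t * Q * Q.comp s * h := by rw [← hkey]; ring
    rw [this]
    exact dvd_sub (dvd_mul_right _ _) (Dvd.intro (C t * Q.comp s * h) (by ring))
  have hdvd' : Q ∣ Q.comp s := hcop.symm.dvd_of_dvd_mul_left hdvd
  -- equal degrees and leading coefficients: `Q(X+t) = Q`
  obtain ⟨w, hw⟩ := hdvd'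
  have hQs : (Q.comp s).natDegree = Q.natDegree := by rw [natDegree_comp, hs1, mul_one]
  have hw0 : w ≠ 0 := by
    rintro rfl; rw [mul_zero] at hw
    rw [comp_eq_zero_iff] at hw
    rcases hw with hw | ⟨_, hw⟩
    · exact hQ0 hw
    · have := congrArg natDegree hw
      rw [hs1, natDegree_C] at this
      exact one_ne_zero this
  have hwdeg : w.natDegree = 0 := by
    have := congrArg natDegree hw
    rw [hQs, natDegree_mul hQ0 hw0] at this
    omega
  have hwC : w = C (w.coeff 0) := eq_C_of_natDegree_eq_zero hwdeg
  have hlc : (Q.comp s).leadingCoeff = Q.leadingCoeff := by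
    rw [leadingCoeff_comp (by rw [hs1]; exact one_ne_zero), hs, leadingCoeff_X_add_C, one_pow,
      mul_one]
  have hw1 : w.coeff 0 = 1 := by
    have h1 := congrArg leadingCoeff hw
    rw [hlc, leadingCoeff_mul, hwC, leadingCoeff_C] at h1
    have hQlc : Q.leadingCoeff ≠ 0 := leadingCoeff_ne_zero.mpr hQ0
    have := mul_left_cancel₀ hQlc (h1.symm.trans (mul_one _).symm)
    rw [hwC, coeff_C_zero]
    exact this
  have hQfix : Q.comp s = Q := by rw [hw, hwC, hw1, C_1, mul_one]
  -- hence `Q` is constant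
  have hQD : Q.natDegree ≤ D :=
    (natDegree_le_of_dvd (Dvd.intro_left d hgQ.symm) hg0).trans hg
  have hQdeg : Q.natDegree = 0 := by
    rcases Nat.eq_zero_or_pos Q.natDegree with h0 | hpos
    · exact h0
    · exact natDegree_eq_zero_of_comp_X_add_C_eq ht (hchar _ hpos hQD) hQfix
  obtain ⟨c, hc⟩ : ∃ c : F, Q = C c := ⟨Q.coeff 0, eq_C_of_natDegree_eq_zero hQdeg⟩
  have hc0 : c ≠ 0 := by rintro rfl; rw [C_0] at hc; exact hQ0 hc
  -- the key identity becomes `P(X+t) − P = C (t c) * h`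
  have hP : P.comp s - P = C (t * c) * h := by
    have h1 : Q * P.comp s - P * Q.comp s = C c * (P.comp s - P) := by
      rw [hQfix, hc]; ring
    have h2 : C t * Q * Q.comp s * h = C c * (C (t * c) * h) := by
      rw [hQfix, hc, C_mul]; ring
    rw [h1, h2] at hkey
    exact mul_left_cancel₀ (by rwa [Ne, C_eq_zero]) hkey
  -- degrees: `deg P − 1 ≤ deg (P(X+t) − P) ≤ k`
  have hPD : P.natDegree ≤ D :=
    (natDegree_le_of_dvd (Dvd.intro_left d hfP.symm) hf0).trans hf
  have hPk : P.natDegree ≤ k + 1 := by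
    rcases Nat.eq_zero_or_pos P.natDegree with h0 | hpos
    · omega
    · have h1 := natDegree_sub_one_le_natDegree_comp_sub (P := P) ht (hchar _ hpos hPD)
      rw [hP] at h1
      have h2 : (C (t * c) * h).natDegree ≤ k := (natDegree_C_mul_le _ _).trans hhk
      omega
  -- contradiction: `f = g · (c⁻¹ P)`
  refine hnd ⟨C c⁻¹ * P, (natDegree_C_mul_le _ _).trans hPk, ?_⟩
  rw [hfP, hgQ, hc, mul_assoc, ← mul_assoc (C c), ← C_mul, mul_inv_cancel₀ hc0, C_1, one_mul]

/-- **Heath-Brown's transfer lemma, case `p ∣ t`** (p. 37–38): with `t = 0` in `F`, i.e.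
`u = g f' − f g'` and `v = g²`, the same conclusion holds.
[cite: HeathBrown2001LargestPrimeFactorCubic, §9 pp. 37–38] -/
theorem not_exists_diffNum_zero_eq_mul {f g : F[X]} {D k : ℕ} (hf : f.natDegree ≤ D)
    (hg : g.natDegree ≤ D) (hg0 : g ≠ 0) (hchar : ∀ n : ℕ, 1 ≤ n → n ≤ D → (n : F) ≠ 0)
    (hnd : ¬ ∃ h : F[X], h.natDegree ≤ k + 1 ∧ f = g * h) :
    ¬ ∃ h : F[X], h.natDegree ≤ k ∧ diffNum (0 : F) f g = diffDen (0 : F) g * h := by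
  rintro ⟨h, hhk, hu⟩
  rw [diffNum_zero, diffDen_zero] at hu
  have hf0 : f ≠ 0 := by
    rintro rfl
    exact hnd ⟨0, by simp, by simp⟩
  obtain ⟨d, P, Q, hd0, hfP, hgQ, hcop⟩ := exists_gcd_decomposition f g hg0
  have hQ0 : Q ≠ 0 := by rintro rfl; rw [mul_zero] at hgQ; exact hg0 hgQ
  have hP0 : P ≠ 0 := by rintro rfl; rw [mul_zero] at hfP; exact hf0 hfP
  -- `g f' − f g' = d² (Q P' − P Q')` and `g² h = d² Q² h`
  have hkey : Q * derivative P - P * derivative Q = Q * Q * h := by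
    have e1 : g * derivative f - f * derivative g =
        d * d * (Q * derivative P - P * derivative Q) := by
      rw [hfP, hgQ, derivative_mul, derivative_mul]; ring
    have e2 : g * g * h = d * d * (Q * Q * h) := by rw [hgQ]; ring
    rw [e1, e2] at hu
    exact mul_left_cancel₀ (mul_ne_zero hd0 hd0) hu
  -- `Q ∣ P Q'`, hence `Q ∣ Q'`, hence `Q' = 0`
  have hdvd : Q ∣ P * derivative Q := by
    have : P * derivative Q = Q * derivative P - Q * Q * h := by rw [← hkey]; ring
    rw [this]
    exact dvd_sub (dvd_mul_right _ _) (Dvd.intro (Q * h) (by ring))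
  have hdvd' : Q ∣ derivative Q := hcop.symm.dvd_of_dvd_mul_left hdvd
  have hQ' : derivative Q = 0 := by
    by_contra hne
    have h1 := natDegree_le_of_dvd hdvd' hne
    have hQd : Q.natDegree ≠ 0 := by
      intro h0
      rw [eq_C_of_natDegree_eq_zero h0, derivative_C] at hne
      exact hne rfl
    have h2 := natDegree_derivative_lt hQd
    omega
  have hQD : Q.natDegree ≤ D :=
    (natDegree_le_of_dvd (Dvd.intro_left d hgQ.symm) hg0).trans hg
  have hQdeg : Q.natDegree = 0 := by
    rcases Nat.eq_zero_or_pos Q.natDegree with h0 | hpos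
    · exact h0
    · exact natDegree_eq_zero_of_derivative_eq_zero (hchar _ hpos hQD) hQ'
  obtain ⟨c, hc⟩ : ∃ c : F, Q = C c := ⟨Q.coeff 0, eq_C_of_natDegree_eq_zero hQdeg⟩
  have hc0 : c ≠ 0 := by rintro rfl; rw [C_0] at hc; exact hQ0 hc
  -- `P' = C c * h`
  have hP : derivative P = C c * h := by
    rw [hc, derivative_C, mul_zero, sub_zero] at hkey
    have : C c * derivative P = C c * (C c * h) := by rw [hkey]; ring
    exact mul_left_cancel₀ (by rwa [Ne, C_eq_zero]) this
  have hPD : P.natDegree ≤ D :=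
    (natDegree_le_of_dvd (Dvd.intro_left d hfP.symm) hf0).trans hf
  have hPk : P.natDegree ≤ k + 1 := by
    rcases Nat.eq_zero_or_pos P.natDegree with h0 | hpos
    · omega
    · have h1 := natDegree_sub_one_le_natDegree_derivative (P := P) (hchar _ hpos hPD)
      rw [hP] at h1
      have h2 : (C c * h).natDegree ≤ k := (natDegree_C_mul_le _ _).trans hhk
      omega
  refine hnd ⟨C c⁻¹ * P, (natDegree_C_mul_le _ _).trans hPk, ?_⟩
  rw [hfP, hgQ, hc, mul_assoc, ← mul_assoc (C c), ← C_mul, mul_inv_cancel₀ hc0, C_1, one_mul]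

/-- **The transfer lemma** (both cases): over a field in which `1, …, D ≠ 0`, for
`deg f, deg g ≤ D`, `g ≠ 0` and ANY `t`, if `f ≠ g h` for all `h` of degree `≤ k + 1` then
`u_t ≠ v_t h` for all `h` of degree `≤ k`.
[cite: HeathBrown2001LargestPrimeFactorCubic, §9 pp. 37–38] -/
theorem not_exists_diffNum_eq_mul {f g : F[X]} {D k : ℕ} (hf : f.natDegree ≤ D)
    (hg : g.natDegree ≤ D) (hg0 : g ≠ 0) (hchar : ∀ n : ℕ, 1 ≤ n → n ≤ D → (n : F) ≠ 0)
    (t : F) (hnd : ¬ ∃ h : F[X], h.natDegree ≤ k + 1 ∧ f = g * h) :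
    ¬ ∃ h : F[X], h.natDegree ≤ k ∧ diffNum t f g = diffDen t g * h := by
  by_cases ht : t = 0
  · subst ht
    exact not_exists_diffNum_zero_eq_mul hf hg hg0 hchar hnd
  · exact not_exists_diffNum_eq_mul_of_ne_zero hf hg hg0 hchar ht hnd

end Field


/-! ### §4. From `ℤ[X]` to `𝔽_p[X]` -/

section ModP

variable {p : ℕ} [Fact p.Prime]

/-- In `𝔽_p` the integers `1, …, D` are non-zero once `D < p`. [folklore] -/
theorem natCast_ne_zero_of_lt {D : ℕ} (hD : D < p) (n : ℕ) (h1 : 1 ≤ n) (hn : n ≤ D) :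
    (n : ZMod p) ≠ 0 := by
  rw [Ne, ZMod.natCast_eq_zero_iff]
  intro h
  have := Nat.le_of_dvd h1 h
  omega

/-- **The transfer lemma modulo `p`** (Heath-Brown p. 37–38, both cases `p ∤ t` and `p ∣ t` at
once): for `f, g ∈ ℤ[X]` of degree `≤ D < p` with `g ≢ 0 (mod p)` and no `h ∈ 𝔽_p[X]` of degree
`≤ k + 1` with `f ≡ g h`, the polynomials `u = diffNum t f g`, `v = diffDen t g` admit no
`h ∈ 𝔽_p[X]` of degree `≤ k` with `u ≡ v h (mod p)`.
[cite: HeathBrown2001LargestPrimeFactorCubic, §9 pp. 37–38] -/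
theorem not_exists_map_diffNum_eq_mul {f g : ℤ[X]} {D k : ℕ} (hD : D < p)
    (hf : f.natDegree ≤ D) (hg : g.natDegree ≤ D)
    (hg0 : g.map (Int.castRingHom (ZMod p)) ≠ 0)
    (hnd : ¬ ∃ h : (ZMod p)[X], h.natDegree ≤ k + 1 ∧
      f.map (Int.castRingHom (ZMod p)) = g.map (Int.castRingHom (ZMod p)) * h) (t : ℤ) :
    ¬ ∃ h : (ZMod p)[X], h.natDegree ≤ k ∧
      (diffNum t f g).map (Int.castRingHom (ZMod p)) =
        (diffDen t g).map (Int.castRingHom (ZMod p)) * h := by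
  rw [map_diffNum, map_diffDen]
  exact not_exists_diffNum_eq_mul (natDegree_map_le.trans hf) (natDegree_map_le.trans hg) hg0
    (natCast_ne_zero_of_lt hD) _ hnd

end ModP

/-! ### §5. The shifted products `a(n + t) \overline{a(n)}` are the terms of a short
Kloosterman sum for `(u, v)` (Heath-Brown (9.3)) -/

section Phase

/-- `e_q(x) = exp(2πi x/q)` on `ℤ/qℤ`, read through `ZMod.val` exactly as in
`shortKloostermanSum`. [cite: HeathBrown2001LargestPrimeFactorCubic, p. 2 (`e_q(m) = exp(2πim/q)`)] -/
def eZMod (q : ℕ) (x : ZMod q) : ℂ :=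
  Complex.exp ((2 * Real.pi * ((x.val : ℕ) : ℝ) / q : ℝ) * Complex.I)

/-- `e_q` is Mathlib's standard additive character of `ℤ/qℤ`. [folklore] -/
theorem eZMod_eq_stdAddChar {q : ℕ} [NeZero q] (x : ZMod q) :
    eZMod q x = ZMod.stdAddChar x := by
  rw [ZMod.stdAddChar_apply, ZMod.toCircle_apply, eZMod]
  congr 1
  push_cast
  ring

/-- `|e_q(x)| = 1`. [folklore] -/
theorem norm_eZMod (q : ℕ) (x : ZMod q) : ‖eZMod q x‖ = 1 :=
  Complex.norm_exp_ofReal_mul_I _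

/-- `e_q(x) \overline{e_q(y)} = e_q(x − y)`. [folklore] -/
theorem eZMod_mul_conj {q : ℕ} [NeZero q] (x y : ZMod q) :
    eZMod q x * starRingEnd ℂ (eZMod q y) = eZMod q (x - y) := by
  rw [eZMod_eq_stdAddChar, eZMod_eq_stdAddChar, eZMod_eq_stdAddChar, ← AddChar.map_neg_eq_conj,
    ← AddChar.map_add_eq_mul, sub_eq_add_neg]

open scoped Classical in
/-- The summand of `shortKloostermanSum`: `e_q(w f(n) \overline{g(n)})` if `(g(n), q) = 1`,
else `0`. [cite: HeathBrown2001LargestPrimeFactorCubic, Thm. 2 (the sum `S`, p. 3)] -/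
def phase (q : ℕ) (f g : ℤ[X]) (w n : ℤ) : ℂ :=
  if IsUnit ((g.eval n : ℤ) : ZMod q) then
    eZMod q ((w : ZMod q) * ((f.eval n : ℤ) : ZMod q) * ((g.eval n : ℤ) : ZMod q)⁻¹)
  else 0

/-- `shortKloostermanSum` is the sum of `phase` over `(A, A + B]`. [folklore] -/
theorem shortKloostermanSum_eq_sum_phase (q : ℕ) (f g : ℤ[X]) (w A : ℤ) (B : ℕ) :
    shortKloostermanSum q f g w A B = ∑ n ∈ Ioc A (A + B), phase q f g w n := by
  unfold shortKloostermanSum phase eZMod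
  rfl

/-- `|phase| ≤ 1`. [folklore] -/
theorem norm_phase_le (q : ℕ) (f g : ℤ[X]) (w n : ℤ) : ‖phase q f g w n‖ ≤ 1 := by
  unfold phase
  split_ifs
  · exact (norm_eZMod _ _).le
  · simp

/-- Heath-Brown's sequence `a(n) = e_q(w f(n)\overline{g(n)})` for `A < n ≤ A + B` (and
`(g(n), q) = 1`), `0` otherwise (p. 36). [cite: HeathBrown2001LargestPrimeFactorCubic, §9 p. 36] -/
def seqA (q : ℕ) (f g : ℤ[X]) (w A : ℤ) (B : ℕ) (n : ℤ) : ℂ :=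
  if n ∈ Ioc A (A + B) then phase q f g w n else 0

/-- `a` vanishes off `(A, A + B]`. [folklore] -/
theorem seqA_eq_zero_of_not_mem {q : ℕ} {f g : ℤ[X]} {w A : ℤ} {B : ℕ} {n : ℤ}
    (hn : n ∉ Ioc A (A + B)) : seqA q f g w A B n = 0 := by
  unfold seqA; rw [if_neg hn]

/-- `|a(n)| ≤ 1`. [folklore] -/
theorem norm_seqA_le (q : ℕ) (f g : ℤ[X]) (w A : ℤ) (B : ℕ) (n : ℤ) :
    ‖seqA q f g w A B n‖ ≤ 1 := by
  unfold seqA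
  split_ifs
  · exact norm_phase_le _ _ _ _ _
  · simp

/-- `S = Σ_n a(n)`. [folklore] -/
theorem sum_seqA (q : ℕ) (f g : ℤ[X]) (w A : ℤ) (B : ℕ) :
    ∑ n ∈ Ioc A (A + B), seqA q f g w A B n = shortKloostermanSum q f g w A B := by
  rw [shortKloostermanSum_eq_sum_phase]
  refine Finset.sum_congr rfl fun n hn => ?_
  unfold seqA; rw [if_pos hn]

/-- **The pointwise identity behind (9.3)**: for `(g(n) g(n+t), q) = 1`,
`e_q(w f(n+t)\overline{g(n+t)}) \overline{e_q(w f(n)\overline{g(n)})} = e_q(w t u(n) \overline{v(n)})`,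
and both sides vanish otherwise; i.e. `phase(f,g,w)(n+t) · \overline{phase(f,g,w)(n)}
= phase(u, v, wt)(n)`. [cite: HeathBrown2001LargestPrimeFactorCubic, §9 p. 37, (9.3)] -/
theorem phase_add_mul_conj_phase (q : ℕ) [NeZero q] (f g : ℤ[X]) (w n t : ℤ) :
    phase q f g w (n + t) * starRingEnd ℂ (phase q f g w n) =
      phase q (diffNum t f g) (diffDen t g) (w * t) n := by
  unfold phase
  -- abbreviations for the residues
  set gn : ZMod q := ((g.eval n : ℤ) : ZMod q) with hgn
  set gnt : ZMod q := ((g.eval (n + t) : ℤ) : ZMod q) with hgnt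
  set fn : ZMod q := ((f.eval n : ℤ) : ZMod q) with hfn
  set fnt : ZMod q := ((f.eval (n + t) : ℤ) : ZMod q) with hfnt
  have hv : (((diffDen t g).eval n : ℤ) : ZMod q) = gn * gnt := by
    rw [eval_diffDen]; push_cast; rfl
  have hu : (t : ZMod q) * (((diffNum t f g).eval n : ℤ) : ZMod q) = gn * fnt - fn * gnt := by
    have := congrArg (fun z : ℤ => (z : ZMod q)) (mul_eval_diffNum t n f g)
    push_cast at this
    exact this
  rw [hv]
  by_cases hgn_u : IsUnit gn
  · by_cases hgnt_u : IsUnit gnt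
    · rw [if_pos hgnt_u, if_pos hgn_u, if_pos (hgn_u.mul hgnt_u), eZMod_mul_conj]
      congr 1
      -- compare after multiplying by the unit `gn * gnt`
      refine (hgn_u.mul hgnt_u).mul_left_inj.mp ?_
      have h1 : ((w : ZMod q) * fnt * gnt⁻¹ - (w : ZMod q) * fn * gn⁻¹) * (gn * gnt) =
          (w : ZMod q) * (gn * fnt - fn * gnt) := by
        have e1 : gnt⁻¹ * gnt = 1 := ZMod.inv_mul_of_unit _ hgnt_u
        have e2 : gn⁻¹ * gn = 1 := ZMod.inv_mul_of_unit _ hgn_u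
        calc ((w : ZMod q) * fnt * gnt⁻¹ - (w : ZMod q) * fn * gn⁻¹) * (gn * gnt)
            = (w : ZMod q) * fnt * gn * (gnt⁻¹ * gnt) - (w : ZMod q) * fn * gnt * (gn⁻¹ * gn) := by
              ring
          _ = _ := by rw [e1, e2]; ring
      have h2 : ((w * t : ℤ) : ZMod q) * (((diffNum t f g).eval n : ℤ) : ZMod q) * (gn * gnt)⁻¹ *
          (gn * gnt) = (w : ZMod q) * (gn * fnt - fn * gnt) := by
        rw [mul_assoc, ZMod.inv_mul_of_unit _ (hgn_u.mul hgnt_u), mul_one, ← hu]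
        push_cast; ring
      rw [h1, h2]
    · -- `g(n+t)` not a unit: both sides vanish
      rw [if_neg hgnt_u, zero_mul, if_neg]
      exact fun h => hgnt_u (IsUnit.mul_iff.mp h).2
  · rw [if_neg hgn_u, map_zero, mul_zero, if_neg]
    exact fun h => hgn_u (IsUnit.mul_iff.mp h).1

/-- **Heath-Brown's (9.3)**: for `0 ≤ t ≤ B`,
`Σ_n a(n + t)\overline{a(n)} = Σ_{A < n ≤ A + B − t} e_q(w t u(n)\overline{v(n)})`, the short
Kloosterman sum of length `B − t` for the pair `(u, v) = (diffNum t f g, diffDen t g)` and the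
multiplier `w t`. [cite: HeathBrown2001LargestPrimeFactorCubic, §9 p. 37, (9.3)] -/
theorem sum_seqA_add_mul_conj (q : ℕ) [NeZero q] (f g : ℤ[X]) (w A : ℤ) {B t : ℕ}
    (ht : t ≤ B) :
    ∑ n ∈ Ioc A (A + B), seqA q f g w A B (n + t) * starRingEnd ℂ (seqA q f g w A B n) =
      shortKloostermanSum q (diffNum t f g) (diffDen t g) (w * t) A (B - t) := by
  rw [shortKloostermanSum_eq_sum_phase]
  have hsub : Ioc A (A + ((B - t : ℕ) : ℤ)) ⊆ Ioc A (A + B) :=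
    Finset.Ioc_subset_Ioc le_rfl (by push_cast [Nat.cast_sub ht]; linarith)
  rw [← Finset.sum_subset hsub]
  · refine Finset.sum_congr rfl fun n hn => ?_
    have hn' : n ∈ Ioc A (A + B) := hsub hn
    have hnt : n + t ∈ Ioc A (A + B) := by
      rw [Finset.mem_Ioc] at hn hn' ⊢
      push_cast [Nat.cast_sub ht] at hn
      constructor <;> linarith
    unfold seqA
    rw [if_pos hnt, if_pos hn', phase_add_mul_conj_phase]
  · intro n hn hn2
    have hnt : n + t ∉ Ioc A (A + B) := by
      rw [Finset.mem_Ioc] at hn hn2 ⊢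
      push_cast [Nat.cast_sub ht] at hn2
      omega
    rw [seqA_eq_zero_of_not_mem hnt, zero_mul]

end Phase

/-! ### §6. The Weyl–van der Corput inequality with step `r` (Heath-Brown (9.2)) -/

section VanDerCorput

open Literature.NumberTheory.LFunctions.VdC (corr corr_neg norm_sq_sum_eq norm_sq_sum_le_card_mul
  sum_Ioc_shift sum_eq_sum_of_vanish)

variable {z : ℤ → ℂ} {a b : ℤ} (hz : ∀ n, n ∉ Finset.Ioc a b → z n = 0)
include hz

/-- **Weyl–van der Corput with step `r`** (Heath-Brown (9.2), before the choice of `H`): for `z`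
supported in `(a, b]`, `r ≥ 1`, `H ≥ 1` with `(H − 1) r ≤ b − a`,
`H² ‖Σ z(n)‖² ≤ (b − a + (H−1) r) · H · (‖C(0)‖ + 2 Σ_{1 ≤ h < H} ‖C(h r)‖)`, where
`C(d) = Σ_n z(n + d)\overline{z(n)}`.  (The tree's `VdC.vanDerCorput_ineq` is the case `r = 1`.)
[cite: HeathBrown2001LargestPrimeFactorCubic, §9 p. 36, (9.2)] -/
theorem vanDerCorput_step {r : ℕ} (hr : 1 ≤ r) {H : ℕ} (hH : 1 ≤ H)
    (hHr : (((H - 1) * r : ℕ) : ℤ) ≤ b - a) :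
    (H : ℝ) ^ 2 * ‖∑ n ∈ Finset.Ioc a b, z n‖ ^ 2
      ≤ ((b : ℝ) - a + ((H - 1) * r : ℕ)) * (H * (‖corr z a b 0‖
          + 2 * ∑ h ∈ Finset.Ico (1 : ℕ) H, ‖corr z a b ((h * r : ℕ) : ℤ)‖)) := by
  set S := ∑ n ∈ Finset.Ioc a b, z n with hS
  -- `M = (a − H r, b − r]`, of length `b − a + (H − 1) r`
  set M : Finset ℤ := Finset.Ioc (a - H * r) (b - r) with hM
  have hab : a ≤ b := by
    have : (0 : ℤ) ≤ (((H - 1) * r : ℕ) : ℤ) := by positivity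
    linarith
  have hlen : (0 : ℤ) ≤ b - r - (a - H * r) := by
    have h1 : (((H - 1) * r : ℕ) : ℤ) = (H : ℤ) * r - r := by
      rw [Nat.cast_mul, Nat.cast_sub hH]; ring
    linarith
  have hcardM : (M.card : ℝ) = (b : ℝ) - a + ((H - 1) * r : ℕ) := by
    rw [hM, Int.card_Ioc]
    have h1 : (((b - r - (a - H * r)).toNat : ℕ) : ℤ) = b - r - (a - H * r) :=
      Int.toNat_of_nonneg hlen
    have h2 : (((b - r - (a - H * r)).toNat : ℕ) : ℝ) = ((b - r - (a - H * r) : ℤ) : ℝ) := by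
      exact_mod_cast h1
    rw [h2]; push_cast [Nat.cast_sub hH]; ring
  -- Step 1: `H S = Σ_{m ∈ M} Σ_{1 ≤ j ≤ H} z(m + j r)`
  have hshift : ∀ j ∈ Finset.Ioc 0 H, ∑ m ∈ M, z (m + (j : ℤ) * r) = S := by
    intro j hj
    rw [Finset.mem_Ioc] at hj
    rw [hM, sum_Ioc_shift, hS]
    refine sum_eq_sum_of_vanish (Finset.Ioc_subset_Ioc ?_ ?_) hz
    · have : (j : ℤ) * r ≤ H * r := by
        have : (j : ℤ) ≤ H := by exact_mod_cast hj.2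
        have : (0 : ℤ) ≤ r := by positivity
        nlinarith
      linarith
    · have : (r : ℤ) ≤ (j : ℤ) * r := by
        have : (1 : ℤ) ≤ j := by exact_mod_cast hj.1
        have : (0 : ℤ) ≤ r := by positivity
        nlinarith
      linarith
  have hHS : (H : ℂ) * S = ∑ m ∈ M, ∑ j ∈ Finset.Ioc 0 H, z (m + (j : ℤ) * r) := by
    rw [Finset.sum_comm, Finset.sum_congr rfl hshift, Finset.sum_const, Nat.card_Ioc,
      Nat.sub_zero, nsmul_eq_mul]
  -- Step 2: Cauchy–Schwarz
  have hCS := norm_sq_sum_le_card_mul M (fun m => ∑ j ∈ Finset.Ioc 0 H, z (m + (j : ℤ) * r))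
  -- Step 3: expand the squares: `Σ_m |Σ_j z(m + jr)|² = Σ_{j,j'} Re C((j − j') r)`
  have hexp : ∑ m ∈ M, ‖∑ j ∈ Finset.Ioc 0 H, z (m + (j : ℤ) * r)‖ ^ 2
      = ∑ j ∈ Finset.Ioc 0 H, ∑ j' ∈ Finset.Ioc 0 H,
          (corr z a b (((j : ℤ) - j') * r)).re := by
    have h1 : ∀ m ∈ M, ‖∑ j ∈ Finset.Ioc 0 H, z (m + (j : ℤ) * r)‖ ^ 2
        = ∑ j ∈ Finset.Ioc 0 H, ∑ j' ∈ Finset.Ioc 0 H,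
            (z (m + (j : ℤ) * r) * (starRingEnd ℂ) (z (m + (j' : ℤ) * r))).re :=
      fun m _ => norm_sq_sum_eq _ _
    rw [Finset.sum_congr rfl h1, Finset.sum_comm]
    refine Finset.sum_congr rfl fun j hj => ?_
    rw [Finset.sum_comm]
    refine Finset.sum_congr rfl fun j' hj' => ?_
    rw [← Complex.re_sum]
    congr 1
    rw [Finset.mem_Ioc] at hj hj'
    have h2 := sum_Ioc_shift (fun n => z (n + ((j : ℤ) - j') * r) * (starRingEnd ℂ) (z n))
      (a - H * r) (b - r) ((j' : ℤ) * r)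
    have h3 : ∀ m : ℤ, z (m + (j : ℤ) * r) * (starRingEnd ℂ) (z (m + (j' : ℤ) * r))
        = z (m + (j' : ℤ) * r + ((j : ℤ) - j') * r) * (starRingEnd ℂ) (z (m + (j' : ℤ) * r)) := by
      intro m
      have : m + (j' : ℤ) * r + ((j : ℤ) - j') * r = m + (j : ℤ) * r := by ring
      rw [this]
    rw [hM, Finset.sum_congr rfl (fun m _ => h3 m), h2]
    unfold corr
    have hj'r : (r : ℤ) ≤ (j' : ℤ) * r := by
      have : (1 : ℤ) ≤ j' := by exact_mod_cast hj'.1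
      have : (0 : ℤ) ≤ r := by positivity
      nlinarith
    have hj'r' : (j' : ℤ) * r ≤ H * r := by
      have : (j' : ℤ) ≤ H := by exact_mod_cast hj'.2
      have : (0 : ℤ) ≤ r := by positivity
      nlinarith
    apply sum_eq_sum_of_vanish (Finset.Ioc_subset_Ioc (by linarith) (by linarith))
    intro n hn
    simp only [hz n hn, map_zero, mul_zero]
  -- Step 4: bound the double sum of correlations
  have hcorr : ∑ j ∈ Finset.Ioc 0 H, ∑ j' ∈ Finset.Ioc 0 H, (corr z a b (((j : ℤ) - j') * r)).re
      ≤ H * (‖corr z a b 0‖ + 2 * ∑ h ∈ Finset.Ico (1 : ℕ) H, ‖corr z a b ((h * r : ℕ) : ℤ)‖) := by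
    have hrow : ∀ j ∈ Finset.Ioc 0 H, ∑ j' ∈ Finset.Ioc 0 H, (corr z a b (((j : ℤ) - j') * r)).re
        ≤ ‖corr z a b 0‖ + 2 * ∑ h ∈ Finset.Ico (1 : ℕ) H, ‖corr z a b ((h * r : ℕ) : ℤ)‖ := by
      intro j hj
      rw [Finset.mem_Ioc] at hj
      have hle : ∀ j' ∈ Finset.Ioc 0 H, (corr z a b (((j : ℤ) - j') * r)).re
          ≤ ‖corr z a b (((j : ℤ) - j') * r)‖ := fun j' _ => Complex.re_le_norm _
      refine (Finset.sum_le_sum hle).trans ?_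
      -- split `(0, H]` into `(0, j − 1]`, `{j}`, `(j, H]`
      rw [← Finset.sum_Ioc_consecutive _ (Nat.zero_le (j - 1)) (by omega : j - 1 ≤ H),
        ← Finset.sum_Ioc_consecutive _ (by omega : j - 1 ≤ j) hj.2]
      have hmid : ∑ j' ∈ Finset.Ioc (j - 1) j, ‖corr z a b (((j : ℤ) - j') * r)‖ = ‖corr z a b 0‖ := by
        have : Finset.Ioc (j - 1) j = {j} := by
          ext x; simp only [Finset.mem_Ioc, Finset.mem_singleton]; omega
        rw [this, Finset.sum_singleton, sub_self, zero_mul]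
      -- lower part: `h = j − j' ∈ [1, j − 1]`
      have hlow : ∑ j' ∈ Finset.Ioc 0 (j - 1), ‖corr z a b (((j : ℤ) - j') * r)‖
          ≤ ∑ h ∈ Finset.Ico (1 : ℕ) H, ‖corr z a b ((h * r : ℕ) : ℤ)‖ := by
        have heq : ∀ j' ∈ Finset.Ioc 0 (j - 1),
            ‖corr z a b (((j : ℤ) - j') * r)‖ = ‖corr z a b (((j - j') * r : ℕ) : ℤ)‖ := by
          intro j' hj'
          rw [Finset.mem_Ioc] at hj'
          congr 3
          rw [Nat.cast_mul, Nat.cast_sub (by omega)]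
        rw [Finset.sum_congr rfl heq,
          ← Finset.sum_image (f := fun h : ℕ => ‖corr z a b ((h * r : ℕ) : ℤ)‖)
            (s := Finset.Ioc 0 (j - 1)) (g := fun j' : ℕ => j - j')]
        · apply Finset.sum_le_sum_of_subset_of_nonneg
          · intro d hd
            rw [Finset.mem_image] at hd
            obtain ⟨j', hj', rfl⟩ := hd
            rw [Finset.mem_Ioc] at hj'
            rw [Finset.mem_Ico]
            omega
          · intro d _ _; exact norm_nonneg _
        · intro x hx y hy hxy
          rw [Finset.coe_Ioc, Set.mem_Ioc] at hx hy
          simp only at hxy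
          omega
      -- upper part: `h = j' − j ∈ [1, H − j]`, using `‖C(−d)‖ = ‖C(d)‖`
      have hup : ∑ j' ∈ Finset.Ioc j H, ‖corr z a b (((j : ℤ) - j') * r)‖
          ≤ ∑ h ∈ Finset.Ico (1 : ℕ) H, ‖corr z a b ((h * r : ℕ) : ℤ)‖ := by
        have hsymm : ∀ j' ∈ Finset.Ioc j H,
            ‖corr z a b (((j : ℤ) - j') * r)‖ = ‖corr z a b (((j' - j) * r : ℕ) : ℤ)‖ := by
          intro j' hj'
          rw [Finset.mem_Ioc] at hj'
          have : ((j : ℤ) - j') * r = -((((j' - j) * r : ℕ) : ℤ)) := by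
            rw [Nat.cast_mul, Nat.cast_sub hj'.1.le]; ring
          rw [this, corr_neg hz (by positivity), Complex.norm_conj]
        rw [Finset.sum_congr rfl hsymm,
          ← Finset.sum_image (f := fun h : ℕ => ‖corr z a b ((h * r : ℕ) : ℤ)‖)
            (s := Finset.Ioc j H) (g := fun j' : ℕ => j' - j)]
        · apply Finset.sum_le_sum_of_subset_of_nonneg
          · intro d hd
            rw [Finset.mem_image] at hd
            obtain ⟨j', hj', rfl⟩ := hd
            rw [Finset.mem_Ioc] at hj'
            rw [Finset.mem_Ico]
            omega
          · intro d _ _; exact norm_nonneg _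
        · intro x hx y hy hxy
          rw [Finset.coe_Ioc, Set.mem_Ioc] at hx hy
          simp only at hxy
          omega
      have hsum0 : 0 ≤ ∑ h ∈ Finset.Ico (1 : ℕ) H, ‖corr z a b ((h * r : ℕ) : ℤ)‖ :=
        Finset.sum_nonneg fun d _ => norm_nonneg _
      rw [hmid]
      linarith
    calc ∑ j ∈ Finset.Ioc 0 H, ∑ j' ∈ Finset.Ioc 0 H, (corr z a b (((j : ℤ) - j') * r)).re
        ≤ ∑ j ∈ Finset.Ioc 0 H, (‖corr z a b 0‖
            + 2 * ∑ h ∈ Finset.Ico (1 : ℕ) H, ‖corr z a b ((h * r : ℕ) : ℤ)‖) :=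
          Finset.sum_le_sum hrow
      _ = H * (‖corr z a b 0‖ + 2 * ∑ h ∈ Finset.Ico (1 : ℕ) H, ‖corr z a b ((h * r : ℕ) : ℤ)‖) := by
          rw [Finset.sum_const, Nat.card_Ioc, Nat.sub_zero, nsmul_eq_mul]
  -- assemble
  have hnormHS : (H : ℝ) ^ 2 * ‖S‖ ^ 2 = ‖(H : ℂ) * S‖ ^ 2 := by
    rw [norm_mul, Complex.norm_natCast]; ring
  rw [hnormHS, hHS]
  calc ‖∑ m ∈ M, ∑ j ∈ Finset.Ioc 0 H, z (m + (j : ℤ) * r)‖ ^ 2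
      ≤ M.card * ∑ m ∈ M, ‖∑ j ∈ Finset.Ioc 0 H, z (m + (j : ℤ) * r)‖ ^ 2 := hCS
    _ = ((b : ℝ) - a + ((H - 1) * r : ℕ)) * ∑ j ∈ Finset.Ioc 0 H, ∑ j' ∈ Finset.Ioc 0 H,
          (corr z a b (((j : ℤ) - j') * r)).re := by rw [hcardM, hexp]
    _ ≤ ((b : ℝ) - a + ((H - 1) * r : ℕ)) * (H * (‖corr z a b 0‖
          + 2 * ∑ h ∈ Finset.Ico (1 : ℕ) H, ‖corr z a b ((h * r : ℕ) : ℤ)‖)) := by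
        apply mul_le_mul_of_nonneg_left hcorr
        rw [← hcardM]; exact Nat.cast_nonneg _

omit hz in
/-- `‖C(0)‖ ≤ b − a` when `|z| ≤ 1`. [folklore] -/
theorem norm_corr_zero_le (hz1 : ∀ n, ‖z n‖ ≤ 1) (hab : a ≤ b) :
    ‖corr z a b 0‖ ≤ (b : ℝ) - a := by
  unfold corr
  refine (norm_sum_le _ _).trans ?_
  have : ∀ n ∈ Finset.Ioc a b, ‖z (n + 0) * (starRingEnd ℂ) (z n)‖ ≤ 1 := by
    intro n _
    rw [add_zero, norm_mul, Complex.norm_conj]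
    have := hz1 n
    have h0 := norm_nonneg (z n)
    nlinarith
  refine (Finset.sum_le_sum this).trans ?_
  rw [Finset.sum_const, nsmul_eq_mul, mul_one, Int.card_Ioc]
  have h1 : (((b - a).toNat : ℕ) : ℤ) = b - a := Int.toNat_of_nonneg (by omega)
  have h2 : (((b - a).toNat : ℕ) : ℝ) = ((b - a : ℤ) : ℝ) := by exact_mod_cast h1
  rw [h2]; push_cast; exact le_rfl

/-- **Heath-Brown's (9.2)**: for `z` supported in `(a, b]` with `|z| ≤ 1`, `B = b − a`, `r ≥ 1`
and `H ≥ 1` with `(H − 1) r ≤ B`,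
`H² |S|² ≤ 2B²H + 4BH Σ_{h=1}^{H−1} |Σ_n z(n + h r)\overline{z(n)}|`.
[cite: HeathBrown2001LargestPrimeFactorCubic, §9 p. 36, (9.2)] -/
theorem vanDerCorput_step' (hz1 : ∀ n, ‖z n‖ ≤ 1) {r : ℕ} (hr : 1 ≤ r) {H : ℕ} (hH : 1 ≤ H)
    (hHr : (((H - 1) * r : ℕ) : ℤ) ≤ b - a) :
    (H : ℝ) ^ 2 * ‖∑ n ∈ Finset.Ioc a b, z n‖ ^ 2
      ≤ 2 * ((b : ℝ) - a) ^ 2 * H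
        + 4 * ((b : ℝ) - a) * H * ∑ h ∈ Finset.Ico (1 : ℕ) H, ‖corr z a b ((h * r : ℕ) : ℤ)‖ := by
  have hab : a ≤ b := by
    have : (0 : ℤ) ≤ (((H - 1) * r : ℕ) : ℤ) := by positivity
    linarith
  have hmain := vanDerCorput_step hz hr hH hHr
  have hC0 := norm_corr_zero_le hz1 hab
  set L : ℝ := (b : ℝ) - a with hL
  set T := ∑ h ∈ Finset.Ico (1 : ℕ) H, ‖corr z a b ((h * r : ℕ) : ℤ)‖ with hT
  have hT0 : 0 ≤ T := Finset.sum_nonneg fun d _ => norm_nonneg _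
  have hab' : (a : ℝ) ≤ b := by exact_mod_cast hab
  have hL0 : 0 ≤ L := by rw [hL]; linarith
  have hHr' : (((H - 1) * r : ℕ) : ℝ) ≤ L := by rw [hL]; exact_mod_cast hHr
  have hH0 : (0 : ℝ) ≤ H := Nat.cast_nonneg _
  calc (H : ℝ) ^ 2 * ‖∑ n ∈ Finset.Ioc a b, z n‖ ^ 2
      ≤ (L + ((H - 1) * r : ℕ)) * (H * (‖corr z a b 0‖ + 2 * T)) := hmain
    _ ≤ (2 * L) * (H * (L + 2 * T)) := by
        apply mul_le_mul (by linarith) _ (by positivity) (by positivity)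
        exact mul_le_mul_of_nonneg_left (by linarith) hH0
    _ = 2 * L ^ 2 * H + 4 * L * H * T := by ring

end VanDerCorput

end ShortKloosterman

end Literature.NumberTheory.Sieve
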